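import Summits.BirchSwinnertonDyer.BirchSwinnertonDyer.Theorems.BiquadraticEisensteinDescentHeegnerFieldSupplyAdmissibilityKleinFour
import Literature.NumberTheory.QuadraticFields.SquareRootGenerator
import Literature.NumberTheory.QuadraticFields.KroneckerSplitting
import HarnessLib

/-!
# Route BiquadraticEisensteinDescent — the biquadratic field `ℚ(√a, √b)`: `p ∤ h` ASCENDS from its
# three quadratic subfields (odd `p`), in the currency of the admissibility conjunct of KS
# (item stmt-BirchSwinnertonDyer-20198)

Companion of `…AdmissibilityKleinFour.lean` (the abstract Klein-four descent). Here the Klein group is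
built for a quartic number field `M` containing square roots `x`, `y` of rational non-squares `a`, `b`
with `ab` a non-square: the conjugations of `M/ℚ(x)` and `M/ℚ(y)` (the tree's `Quadratic.conj`,
`SquareRootGenerator.lean`) restricted to `ℚ` commute (their commutator squared fixes `x` and `y`, and
`Gal(M/ℚ(x))` has at most `[M : ℚ(x)] = 2` elements), their fixed fields are quadratic and contain
`x`, `y`, `xy`. Main result:

* **`forall_quartic_not_dvd_classNumber_of_quadratic`** — if every quadratic field containing `√a`
  (resp. `√b`, `√(ab)`) has class number prime to the odd prime `p`, then every quartic field
  containing `√a` and `√b` has class number prime to `p` — literally the shape of the admissibility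
  binder of `HeegnerFieldSupplyCMInertBadAdm` with `a = d_CM`, `b = d_K′`.

Auxiliaries: `minpoly_eq_of_sq_eq` / `finrank_adjoin_sqrt` (`[ℚ(√a) : ℚ] = 2`, via the tree's
`irreducible_X_sq_sub_of_not_isSquare`), `sq_or_mul_sq_of_mem_adjoin` (an element of `ℚ(√a)` with
rational square `b` forces `b` or `ab` to be a square), `nonempty_algEquiv_of_sq_eq` (two quadratic
fields with a square root of the same non-square are isomorphic, `AdjoinRoot` of the common minimal
polynomial). Theorem-only file, unconditional; helper toward KS (`--supports`
stmt-BirchSwinnertonDyer-20198). Prover seat bsd-wall-bed-p2 (g6), 2026-08-27.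

References: [Marcus2018] Ch. 2 Thm. 1, Ch. 4 (biquadratic fields); [Washington1997] §10.2;
[Lemmermeyer1994] (Kuroda's formula, context).
-/

set_option autoImplicit false

-- D-0017 layout: summit = sub-problem, so `Summit.BirchSwinnertonDyer.BirchSwinnertonDyer.…` is the mandated namespace.
set_option linter.dupNamespace false

open scoped NumberField Pointwise
open Module NumberField IntermediateField Polynomial
open Literature.NumberTheory.NumberFields
open Summit.BirchSwinnertonDyer.BirchSwinnertonDyer.Theorems.BiquadraticEisensteinDescentHeegnerFieldSupplyAdmissibilityKleinFour

namespace Summit.BirchSwinnertonDyer.BirchSwinnertonDyer.Theorems.BiquadraticEisensteinDescentHeegnerFieldSupplyAdmissibilityOfQuadratic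

variable (M : Type) [Field M] [NumberField M]

/-! ### Square roots of rationals inside a number field -/

section SquareRoots

variable {M}

/-- A square root of a rational non-square is irrational. [folklore] -/
theorem not_mem_range_of_sq_eq {x : M} {a : ℚ} (hx : x ^ 2 = algebraMap ℚ M a)
    (ha : ∀ r : ℚ, r ^ 2 ≠ a) : x ∉ Set.range (algebraMap ℚ M) := by
  rintro ⟨r, rfl⟩
  apply ha r
  apply (algebraMap ℚ M).injective
  rw [map_pow, hx]

/-- The minimal polynomial of a square root `x` of a rational non-square `a` is `X² − a`
(irreducible as `a` is not a square — the tree's `irreducible_X_sq_sub_of_not_isSquare`). [folklore] -/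
theorem minpoly_eq_of_sq_eq (x : M) {a : ℚ} (hx : x ^ 2 = algebraMap ℚ M a)
    (ha : ∀ r : ℚ, r ^ 2 ≠ a) : minpoly ℚ x = X ^ 2 - C a := by
  have hns : ¬ IsSquare ((0 : ℚ) ^ 2 + 4 * a) := by
    rintro ⟨s, hs⟩
    apply ha (s / 2)
    have : (4 : ℚ) * a = s * s := by rw [← hs]; ring
    field_simp
    linarith [this]
  have hirr := Literature.NumberTheory.QuadraticFields.Quadratic.irreducible_X_sq_sub_of_not_isSquare hns
  have hpoly : (X ^ 2 - C (0 : ℚ) * X - C a : ℚ[X]) = X ^ 2 - C a := by simp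
  rw [hpoly] at hirr
  have hmonic : (X ^ 2 - C a : ℚ[X]).Monic := by
    simpa using Polynomial.monic_X_pow_sub_C a two_ne_zero
  have haeval : aeval x (X ^ 2 - C a : ℚ[X]) = 0 := by simp [hx]
  exact (minpoly.eq_of_irreducible_of_monic hirr haeval hmonic).symm

/-- A square root of a rational number is integral over `ℚ`. [folklore] -/
theorem isIntegral_of_sq_eq (x : M) {a : ℚ} (hx : x ^ 2 = algebraMap ℚ M a) : IsIntegral ℚ x :=
  ⟨X ^ 2 - C a, by simpa using Polynomial.monic_X_pow_sub_C a two_ne_zero, by simp [hx]⟩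

/-- `[ℚ(x) : ℚ] = 2` for a square root `x` of a rational non-square `a`. [folklore] -/
theorem finrank_adjoin_sqrt (x : M) {a : ℚ} (hx : x ^ 2 = algebraMap ℚ M a)
    (ha : ∀ r : ℚ, r ^ 2 ≠ a) : finrank ℚ ℚ⟮x⟯ = 2 := by
  rw [IntermediateField.adjoin.finrank (isIntegral_of_sq_eq x hx), minpoly_eq_of_sq_eq x hx ha,
    Polynomial.natDegree_X_pow_sub_C]

/-- In a QUADRATIC field, a square root `x` of a rational non-square generates: `ℚ(x) = F`.
[folklore] -/
theorem adjoin_sqrt_eq_top {F : Type} [Field F] [NumberField F] (h2 : finrank ℚ F = 2) (x : F)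
    {a : ℚ} (hx : x ^ 2 = algebraMap ℚ F a) (ha : ∀ r : ℚ, r ^ 2 ≠ a) : ℚ⟮x⟯ = ⊤ :=
  IntermediateField.eq_of_le_of_finrank_eq le_top
    (by rw [finrank_adjoin_sqrt x hx ha, IntermediateField.finrank_top', h2])

/-- **Two quadratic fields containing square roots of the same rational non-square are isomorphic**
(both are `ℚ[X]/(X² − a)`). [folklore] -/
theorem nonempty_algEquiv_of_sq_eq {F F' : Type} [Field F] [NumberField F] [Field F']
    [NumberField F'] (h2 : finrank ℚ F = 2) (h2' : finrank ℚ F' = 2) {a : ℚ}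
    (ha : ∀ r : ℚ, r ^ 2 ≠ a) {x : F} (hx : x ^ 2 = algebraMap ℚ F a) {x' : F'}
    (hx' : x' ^ 2 = algebraMap ℚ F' a) : Nonempty (F ≃ₐ[ℚ] F') := by
  have hmin : minpoly ℚ x = minpoly ℚ x' := by
    rw [minpoly_eq_of_sq_eq x hx ha, minpoly_eq_of_sq_eq x' hx' ha]
  let e₂ : ℚ⟮x⟯ ≃ₐ[ℚ] ℚ⟮x'⟯ :=
    (IntermediateField.adjoinRootEquivAdjoin ℚ (isIntegral_of_sq_eq x hx)).symm.trans
      ((AdjoinRoot.algEquivOfEq ℚ _ _ hmin).trans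
        (IntermediateField.adjoinRootEquivAdjoin ℚ (isIntegral_of_sq_eq x' hx')))
  let e₁ : F ≃ₐ[ℚ] ℚ⟮x⟯ :=
    IntermediateField.topEquiv.symm.trans
      (IntermediateField.equivOfEq (adjoin_sqrt_eq_top h2 x hx ha).symm)
  let e₃ : ℚ⟮x'⟯ ≃ₐ[ℚ] F' :=
    (IntermediateField.equivOfEq (adjoin_sqrt_eq_top h2' x' hx' ha)).trans IntermediateField.topEquiv
  exact ⟨(e₁.trans e₂).trans e₃⟩

/-- If `x² = a`, `x ∉ ℚ`, and `y ∈ ℚ(x)` has rational square `b`, then `b` or `ab` is a rational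
square (write `y = u + vx`; `y² ∈ ℚ` forces `uv = 0`). [folklore] -/
theorem sq_or_mul_sq_of_mem_adjoin {x y : M} {a b : ℚ} (hx : x ^ 2 = algebraMap ℚ M a)
    (hxr : x ∉ Set.range (algebraMap ℚ M)) (hy : y ∈ ℚ⟮x⟯) (hyb : y ^ 2 = algebraMap ℚ M b) :
    (∃ r : ℚ, r ^ 2 = b) ∨ (∃ r : ℚ, r ^ 2 = a * b) := by
  have hmonic : (X ^ 2 - C a : ℚ[X]).Monic := by
    simpa using Polynomial.monic_X_pow_sub_C a two_ne_zero
  have hq0 : aeval x (X ^ 2 - C a : ℚ[X]) = 0 := by simp [hx]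
  have hint : IsIntegral ℚ x := ⟨X ^ 2 - C a, hmonic, by simpa using hq0⟩
  -- `y` is a polynomial in `x`, reduced modulo `X² − a` to degree `≤ 1`
  have hmem : y ∈ (Algebra.adjoin ℚ {x} : Subalgebra ℚ M) := by
    rw [← IntermediateField.adjoin_simple_toSubalgebra_of_isAlgebraic hint.isAlgebraic]
    exact hy
  rw [Algebra.adjoin_singleton_eq_range_aeval] at hmem
  obtain ⟨f, hf⟩ := hmem
  set r := f %ₘ (X ^ 2 - C a) with hr
  have hry : aeval x r = y := by rw [hr, Polynomial.aeval_modByMonic_eq_self_of_root hq0]; exact hf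
  have hdeg : r.degree ≤ 1 := by
    have h := Polynomial.degree_modByMonic_lt f hmonic
    rw [Polynomial.degree_X_pow_sub_C (by norm_num) a] at h
    rw [← hr] at h
    have : r.degree < 2 := h
    -- `degree < 2` means `≤ 1`
    rcases lt_or_ge r.degree 2 with h2 | h2
    · exact Order.le_of_lt_succ (by exact_mod_cast this)
    · exact absurd this (not_lt.mpr h2)
  set u := r.coeff 0
  set v := r.coeff 1
  have hyuv : y = algebraMap ℚ M u + algebraMap ℚ M v * x := by
    rw [← hry, Polynomial.eq_X_add_C_of_degree_le_one hdeg]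
    simp only [map_add, map_mul, aeval_C, aeval_X]
    ring
  -- square it: `(2uv)·x = b − u² − a v²`
  have hsq : algebraMap ℚ M (2 * u * v) * x = algebraMap ℚ M (b - u ^ 2 - a * v ^ 2) := by
    have h := hyb
    rw [hyuv] at h
    simp only [map_sub, map_mul, map_pow, map_ofNat] at h ⊢
    linear_combination h - (algebraMap ℚ M v) ^ 2 * hx
  by_cases huv : u * v = 0
  · rcases mul_eq_zero.mp huv with hu | hv
    · -- `y = v x`, `b = a v²`
      right
      refine ⟨a * v, ?_⟩
      apply (algebraMap ℚ M).injective
      have h := hyb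
      rw [hyuv, hu, map_zero, zero_add, mul_pow, hx] at h
      simp only [map_mul, map_pow] at h ⊢
      linear_combination (algebraMap ℚ M a) * h
    · -- `y = u`, `b = u²`
      left
      refine ⟨u, ?_⟩
      apply (algebraMap ℚ M).injective
      have h := hyb
      rw [hyuv, hv, map_zero, zero_mul, add_zero, ← map_pow] at h
      exact h
  · exfalso
    apply hxr
    refine ⟨(b - u ^ 2 - a * v ^ 2) / (2 * u * v), ?_⟩
    have hne : algebraMap ℚ M (2 * u * v) ≠ 0 := by
      rw [_root_.map_ne_zero]
      intro h0
      exact huv (by linarith [h0])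
    rw [map_div₀, div_eq_iff hne]
    linear_combination -hsq

/-- Hence a square root `y` of `b` does not lie in `ℚ(x)` if neither `b` nor `ab` is a rational
square. [folklore] -/
theorem not_mem_range_adjoin_of_sq_eq {x y : M} {a b : ℚ} (hx : x ^ 2 = algebraMap ℚ M a)
    (ha : ∀ r : ℚ, r ^ 2 ≠ a) (hyb : y ^ 2 = algebraMap ℚ M b) (hb : ∀ r : ℚ, r ^ 2 ≠ b)
    (hab : ∀ r : ℚ, r ^ 2 ≠ a * b) : y ∉ Set.range (algebraMap ℚ⟮x⟯ M) := by
  rintro ⟨e, rfl⟩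
  have hmem : (algebraMap ℚ⟮x⟯ M e) ∈ ℚ⟮x⟯ := e.2
  rcases sq_or_mul_sq_of_mem_adjoin hx (not_mem_range_of_sq_eq hx ha) hmem hyb with ⟨r, hr⟩ | ⟨r, hr⟩
  · exact hb r hr
  · exact hab r hr

/-- An automorphism fixing `x` fixes `ℚ(x)` pointwise, i.e. lies in its fixing subgroup. [folklore] -/
theorem mem_fixingSubgroup_adjoin_of_apply_eq {x : M} (κ : M ≃ₐ[ℚ] M) (hκ : κ x = x) :
    κ ∈ (ℚ⟮x⟯).fixingSubgroup := by
  have hle : ℚ⟮x⟯ ≤ fixedField (Subgroup.zpowers κ) := by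
    rw [IntermediateField.adjoin_simple_le_iff, IntermediateField.mem_fixedField_iff]
    intro f hf
    have h : Subgroup.zpowers κ ≤ MulAction.stabilizer (M ≃ₐ[ℚ] M) x :=
      (Subgroup.zpowers_le.mpr (MulAction.mem_stabilizer_iff.mpr hκ))
    exact MulAction.mem_stabilizer_iff.mp (h hf)
  rw [IntermediateField.mem_fixingSubgroup_iff]
  intro z hz
  have hz' := hle hz
  rw [IntermediateField.mem_fixedField_iff] at hz'
  exact hz' κ (Subgroup.mem_zpowers κ)

end SquareRoots

/-! ### The biquadratic field `ℚ(√a, √b)` and its Klein four-group -/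

/-- **`p ∤ h` ascends from the three quadratic subfields to the biquadratic field** (odd `p`), in
the currency of the admissibility conjunct of KS: if `a`, `b`, `ab` are rational non-squares and every
QUADRATIC number field containing a square root of `a` (resp. `b`, resp. `ab`) has class number prime
to `p`, then every QUARTIC number field containing square roots of `a` and of `b` has class number
prime to `p`. (Such a quartic `M` is `ℚ(√a, √b)`, Galois with group `{1, σ₁, σ₂, σ₁σ₂}` generated by
the conjugations of `M/ℚ(√a)` and `M/ℚ(√b)` — the tree's `Quadratic.conj` — whose fixed fields are
quadratic and contain `√a`, `√b`, `√a√b`; conclude by `not_dvd_classNumber_of_kleinFour`.) For the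
route: with `a = d_CM`, `b = d_K′` this says that `p ∤ h(K_CM)`, `p ∤ h(K′)`, `p ∤ h(ℚ(√(d_CM d_K′)))`
(each in the «every quadratic field with a square root of …» form) imply the quartic admissibility
binder of `HeegnerFieldSupplyCMInertBadAdm` (stmt-BirchSwinnertonDyer-20198). [folklore] -/
theorem forall_quartic_not_dvd_classNumber_of_quadratic {a b : ℤ} {p : ℕ} (hp : p.Prime)
    (hp2 : p ≠ 2) (ha : ∀ r : ℚ, r ^ 2 ≠ a) (hb : ∀ r : ℚ, r ^ 2 ≠ b)
    (hab : ∀ r : ℚ, r ^ 2 ≠ a * b)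
    (hA : ∀ (F : Type) [Field F] [NumberField F], finrank ℚ F = 2 →
      (∃ z : F, z ^ 2 = ((a : ℤ) : F)) → ¬ p ∣ classNumber F)
    (hB : ∀ (F : Type) [Field F] [NumberField F], finrank ℚ F = 2 →
      (∃ z : F, z ^ 2 = ((b : ℤ) : F)) → ¬ p ∣ classNumber F)
    (hAB : ∀ (F : Type) [Field F] [NumberField F], finrank ℚ F = 2 →
      (∃ z : F, z ^ 2 = ((a * b : ℤ) : F)) → ¬ p ∣ classNumber F) :
    ∀ (M : Type) [Field M] [NumberField M], finrank ℚ M = 4 →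
      (∃ x : M, x ^ 2 = ((a : ℤ) : M)) → (∃ y : M, y ^ 2 = ((b : ℤ) : M)) →
      ¬ p ∣ classNumber M := by
  intro M _ _ h4 hx hy
  classical
  obtain ⟨x, hxa⟩ := hx
  obtain ⟨y, hyb⟩ := hy
  have hxa' : x ^ 2 = algebraMap ℚ M (a : ℚ) := by rw [hxa, map_intCast]
  have hyb' : y ^ 2 = algebraMap ℚ M (b : ℚ) := by rw [hyb, map_intCast]
  have ha' : ∀ r : ℚ, r ^ 2 ≠ (a : ℚ) := ha
  have hb' : ∀ r : ℚ, r ^ 2 ≠ (b : ℚ) := hb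
  have hab' : ∀ r : ℚ, r ^ 2 ≠ (a : ℚ) * (b : ℚ) := by exact_mod_cast hab
  have hba' : ∀ r : ℚ, r ^ 2 ≠ (b : ℚ) * (a : ℚ) := fun r h => hab' r (by rw [h, mul_comm])
  have hx0 : x ≠ 0 := fun h => ha' 0 (by
    apply (algebraMap ℚ M).injective; rw [map_pow, ← hxa', h, map_zero])
  have hy0 : y ≠ 0 := fun h => hb' 0 (by
    apply (algebraMap ℚ M).injective; rw [map_pow, ← hyb', h, map_zero])
  -- degrees
  have hxr := not_mem_range_of_sq_eq hxa' ha'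
  have hyr := not_mem_range_of_sq_eq hyb' hb'
  have h2x : finrank ℚ ℚ⟮x⟯ = 2 := finrank_adjoin_sqrt x hxa' ha'
  have h2y : finrank ℚ ℚ⟮y⟯ = 2 := finrank_adjoin_sqrt y hyb' hb'
  have h2Mx : finrank ℚ⟮x⟯ M = 2 := by
    have h := Module.finrank_mul_finrank ℚ ℚ⟮x⟯ M
    rw [h2x, h4] at h
    omega
  have h2My : finrank ℚ⟮y⟯ M = 2 := by
    have h := Module.finrank_mul_finrank ℚ ℚ⟮y⟯ M
    rw [h2y, h4] at h
    omega
  -- the conjugation of `M / ℚ(x)` : `y ↦ −y`, and of `M / ℚ(y)` : `x ↦ −x`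
  have hyE : y ∉ Set.range (algebraMap ℚ⟮x⟯ M) := not_mem_range_adjoin_of_sq_eq hxa' ha' hyb' hb' hab'
  have hxE : x ∉ Set.range (algebraMap ℚ⟮y⟯ M) := not_mem_range_adjoin_of_sq_eq hyb' hb' hxa' ha' hba'
  have hcy : y ^ 2 = algebraMap ℚ⟮x⟯ M (algebraMap ℚ ℚ⟮x⟯ (b : ℚ)) := by
    rw [← IsScalarTower.algebraMap_apply]; exact hyb'
  have hcx : x ^ 2 = algebraMap ℚ⟮y⟯ M (algebraMap ℚ ℚ⟮y⟯ (a : ℚ)) := by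
    rw [← IsScalarTower.algebraMap_apply]; exact hxa'
  let c₁ := Literature.NumberTheory.QuadraticFields.Quadratic.conj h2Mx hyE hcy
  let c₂ := Literature.NumberTheory.QuadraticFields.Quadratic.conj h2My hxE hcx
  have hc₁c₁ : Function.Involutive c₁ :=
    Literature.NumberTheory.QuadraticFields.Quadratic.conj_conj h2Mx hyE hcy
  have hc₂c₂ : Function.Involutive c₂ :=
    Literature.NumberTheory.QuadraticFields.Quadratic.conj_conj h2My hxE hcx
  let σ₁ : M ≃ₐ[ℚ] M := (AlgEquiv.ofBijective c₁ hc₁c₁.bijective).restrictScalars ℚ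
  let σ₂ : M ≃ₐ[ℚ] M := (AlgEquiv.ofBijective c₂ hc₂c₂.bijective).restrictScalars ℚ
  have hσ₁y : σ₁ y = -y := Literature.NumberTheory.QuadraticFields.Quadratic.conj_gen h2Mx hyE hcy
  have hσ₂x : σ₂ x = -x := Literature.NumberTheory.QuadraticFields.Quadratic.conj_gen h2My hxE hcx
  have hσ₁x : σ₁ x = x := by
    have h := Literature.NumberTheory.QuadraticFields.Quadratic.conj_algebraMap h2Mx hyE hcy
      ⟨x, IntermediateField.mem_adjoin_simple_self ℚ x⟩
    exact h
  have hσ₂y : σ₂ y = y := by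
    have h := Literature.NumberTheory.QuadraticFields.Quadratic.conj_algebraMap h2My hxE hcx
      ⟨y, IntermediateField.mem_adjoin_simple_self ℚ y⟩
    exact h
  have hs₁ : σ₁ * σ₁ = 1 := by ext z; exact hc₁c₁ z
  have hs₂ : σ₂ * σ₂ = 1 := by ext z; exact hc₂c₂ z
  have hneg : ∀ z : M, z ≠ 0 → -z ≠ z := fun z hz h => hz (by
    have : (2 : M) * z = 0 := by linear_combination -h
    simpa using this)
  have h₁ : σ₁ ≠ 1 := fun h => hneg y hy0 (by rw [← hσ₁y, h, AlgEquiv.one_apply])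
  have h₂ : σ₂ ≠ 1 := fun h => hneg x hx0 (by rw [← hσ₂x, h, AlgEquiv.one_apply])
  have h₁₂ : σ₁ ≠ σ₂ := fun h => hneg x hx0 (by rw [← hσ₂x, ← h, hσ₁x])
  -- commutation: `κ = (σ₁σ₂)²` fixes `x` and `y`, hence is trivial (it is an element of
  -- `Gal(M/ℚ(x)) = {1, c₁}` fixing `y`)
  have hcomm : σ₁ * σ₂ = σ₂ * σ₁ := by
    set κ := σ₁ * σ₂ * (σ₁ * σ₂) with hκdef
    have hκx : κ x = x := by
      simp only [hκdef, AlgEquiv.mul_apply, hσ₂x, map_neg, hσ₁x, neg_neg]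
    have hκy : κ y = y := by
      simp only [hκdef, AlgEquiv.mul_apply, hσ₂y, hσ₁y, map_neg, neg_neg]
    have hκmem := mem_fixingSubgroup_adjoin_of_apply_eq κ hκx
    let κE : M ≃ₐ[ℚ⟮x⟯] M := fixingSubgroupEquiv ℚ⟮x⟯ ⟨κ, hκmem⟩
    have hκEy : κE y = y := hκy
    let c₁E : M ≃ₐ[ℚ⟮x⟯] M := AlgEquiv.ofBijective c₁ hc₁c₁.bijective
    have hc₁Ey : c₁E y = -y := Literature.NumberTheory.QuadraticFields.Quadratic.conj_gen h2Mx hyE hcy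
    have hκE1 : κE = 1 := by
      by_contra hne
      have hne' : κE ≠ c₁E := fun h => hneg y hy0 (by rw [← hc₁Ey, ← h, hκEy])
      have hc1 : c₁E ≠ 1 := fun h => hneg y hy0 (by rw [← hc₁Ey, h, AlgEquiv.one_apply])
      have hcard : ({1, c₁E, κE} : Finset (M ≃ₐ[ℚ⟮x⟯] M)).card = 3 :=
        Finset.card_eq_three.mpr ⟨1, c₁E, κE, hc1.symm, fun h => hne h.symm, hne'.symm, rfl⟩
      have hle : ({1, c₁E, κE} : Finset (M ≃ₐ[ℚ⟮x⟯] M)).card ≤ finrank ℚ⟮x⟯ M :=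
        (Finset.card_le_univ _).trans AlgEquiv.card_le
      rw [hcard, h2Mx] at hle
      omega
    have hκ1 : κ = 1 := by
      ext z
      have h := AlgEquiv.congr_fun hκE1 z
      exact h
    -- `(σ₁σ₂)² = 1` with `σᵢ² = 1` gives commutation
    have hinv₁ : σ₁⁻¹ = σ₁ := inv_eq_of_mul_eq_one_right hs₁
    have hinv₂ : σ₂⁻¹ = σ₂ := inv_eq_of_mul_eq_one_right hs₂
    calc σ₁ * σ₂ = (σ₁ * σ₂)⁻¹ := (inv_eq_of_mul_eq_one_right hκ1).symm
      _ = σ₂⁻¹ * σ₁⁻¹ := mul_inv_rev σ₁ σ₂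
      _ = σ₂ * σ₁ := by rw [hinv₁, hinv₂]
  -- the three fixed fields are quadratic and contain `x`, `y`, `xy`
  have h₃ne : σ₁ * σ₂ ≠ 1 := by
    intro h
    apply h₁₂
    calc σ₁ = σ₁ * (σ₂ * σ₂) := by rw [hs₂, mul_one]
      _ = (σ₁ * σ₂) * σ₂ := by rw [mul_assoc]
      _ = σ₂ := by rw [h, one_mul]
  have hs₃ : (σ₁ * σ₂) * (σ₁ * σ₂) = 1 := by
    calc (σ₁ * σ₂) * (σ₁ * σ₂) = σ₁ * (σ₂ * σ₁) * σ₂ := by simp only [mul_assoc]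
      _ = σ₁ * (σ₁ * σ₂) * σ₂ := by rw [hcomm]
      _ = (σ₁ * σ₁) * (σ₂ * σ₂) := by simp only [mul_assoc]
      _ = 1 := by rw [hs₁, hs₂, one_mul]
  have hquad : ∀ σ : M ≃ₐ[ℚ] M, σ ≠ 1 → σ * σ = 1 →
      finrank ℚ (fixedField (Subgroup.zpowers σ)) = 2 := by
    intro σ hσ1 hσσ
    have h := Module.finrank_mul_finrank ℚ (fixedField (Subgroup.zpowers σ)) M
    rw [finrank_fixedField_zpowers_eq_two M σ hσ1 hσσ, h4] at h
    omega
  have hF₁ : ¬ p ∣ classNumber (fixedField (Subgroup.zpowers σ₁)) := by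
    refine hA _ (hquad σ₁ h₁ hs₁) ⟨⟨x, mem_fixedField_zpowers_of_apply_eq σ₁ hσ₁x⟩, ?_⟩
    apply Subtype.ext
    push_cast
    exact hxa
  have hF₂ : ¬ p ∣ classNumber (fixedField (Subgroup.zpowers σ₂)) := by
    refine hB _ (hquad σ₂ h₂ hs₂) ⟨⟨y, mem_fixedField_zpowers_of_apply_eq σ₂ hσ₂y⟩, ?_⟩
    apply Subtype.ext
    push_cast
    exact hyb
  have hF₃ : ¬ p ∣ classNumber (fixedField (Subgroup.zpowers (σ₁ * σ₂))) := by
    have hxy : (σ₁ * σ₂) (x * y) = x * y := by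
      rw [AlgEquiv.mul_apply, map_mul, hσ₂x, hσ₂y, map_mul, map_neg, hσ₁x, hσ₁y]; ring
    refine hAB _ (hquad (σ₁ * σ₂) h₃ne hs₃)
      ⟨⟨x * y, mem_fixedField_zpowers_of_apply_eq (σ₁ * σ₂) hxy⟩, ?_⟩
    apply Subtype.ext
    push_cast
    rw [mul_pow, hxa, hyb]
  exact not_dvd_classNumber_of_kleinFour M hp hp2 σ₁ σ₂ h₁ h₂ h₁₂ hs₁ hs₂ hcomm hF₁ hF₂ hF₃

end Summit.BirchSwinnertonDyer.BirchSwinnertonDyer.Theorems.BiquadraticEisensteinDescentHeegnerFieldSupplyAdmissibilityOfQuadratic
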